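import Mathlib.Analysis.Calculus.Deriv.Slope
import Mathlib.Analysis.Calculus.Deriv.Comp
import Mathlib.Analysis.Calculus.Deriv.Add
import Mathlib.Analysis.Calculus.Deriv.Mul
import Mathlib.Analysis.Normed.Module.Convex
import Mathlib.Topology.Order.OrderClosed

/-!
# Lawson–Michelsohn (1984), Theorem 6.1 in `ℝ^{m+1}` — proof file, part 2: the compact domain
# `{F ≤ 0}` presented by a function regular on its zero set

Topic `Geometry/Riemannian`; namespace `Literature.Geometry.Riemannian`. Companion of
`MeanConvexSurrounding.lean` (the named fact
`Literature.Geometry.Riemannian.LawsonMichelsohn1984_surrounding`, Lawson–Michelsohn, Invent.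
Math. 77 (1984), Thm. (6.1) for `M̄ = ℝ^{m+1}`) and of `MeanConvexSurroundingProofs.lean`.
Everything in this file is **proved**; no statement is introduced.

Both the hypothesis and the conclusion of the fact speak of a compact domain in the
implicit-function model: `D = {F ≤ 0}` for a function `F` with `dF(x) ≠ 0` at every point of
`{F = 0}`. The paper's `D_f` is "the compact domain bounded by `f(N)`", for `M̄ = ℝⁿ` "just the
bounded component of `ℝⁿ - N`" (op. cit. p. 416). This file records the point-set topology
identifying the two descriptions, for a real normed space `E`, `F : E → ℝ` continuous and
regular on its zero set (no compactness is needed):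

* `mem_closure_setOf_pos_of_hasFDerivAt`, `mem_closure_setOf_neg_of_hasFDerivAt` — a regular
  zero `x` of `F` is in the closure of `{F > 0}` and of `{F < 0}` (move along a direction `u` with
  `dF(x) u ≠ 0`);
* `closure_setOf_neg_eq` (`closure {F < 0} = {F ≤ 0}`), `interior_setOf_nonpos_eq`
  (`interior {F ≤ 0} = {F < 0}`), `frontier_setOf_nonpos_eq` and `frontier_setOf_neg_eq`
  (`∂{F ≤ 0} = ∂{F < 0} = {F = 0}`): the zero set *is* the topological boundary of `D`, and
  `{F < 0}` its interior;
* `setOf_neg_nonempty` — a nonempty regular zero set forces `{F < 0} ≠ ∅`;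
* `isConnected_setOf_nonpos` — if the zero set is connected (and nonempty) then so is
  `D = {F ≤ 0}` (here only continuity is used): every relatively clopen piece of `D` missing
  `{F = 0}` would be clopen in the connected space `E`. (With `{F = 0} = e(N)`, `N` connected,
  this is the connectedness of the paper's `D_f`.)

## References

* H. B. Lawson, Jr., M.-L. Michelsohn, *Embedding and surrounding with positive mean curvature*,
  Invent. Math. 77 (1984), 399–419, doi:10.1007/bf01388830: §6, Thm. (6.1) and the remark
  following it (p. 416). [LawsonMichelsohn1984]
-/

noncomputable section

open Set Filter
open scoped _root_.Topology

namespace Literature.Geometry.Riemannian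

variable {E : Type*} [NormedAddCommGroup E] [NormedSpace ℝ E]

/-! ### A regular zero is approached from both sides -/

/-- If `F` has derivative `L ≠ 0` at a zero `x`, then `x` lies in the closure of `{F > 0}`:
along a direction `u` with `L u > 0` the function becomes positive. [folklore] -/
theorem mem_closure_setOf_pos_of_hasFDerivAt {F : E → ℝ} {L : E →L[ℝ] ℝ} {x : E}
    (hF : HasFDerivAt F L x) (hx : F x = 0) (hL : L ≠ 0) : x ∈ closure {y | 0 < F y} := by
  obtain ⟨u₀, hu₀⟩ : ∃ u, L u ≠ 0 := by simpa using DFunLike.ne_iff.mp hL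
  obtain ⟨u, hu⟩ : ∃ u, 0 < L u := by
    rcases hu₀.lt_or_gt with h | h
    · exact ⟨-u₀, by simpa using h⟩
    · exact ⟨u₀, h⟩
  -- the function along the ray `t ↦ x + t • u`
  have hγ : HasDerivAt (fun t : ℝ => x + t • u) u 0 := by
    simpa using ((hasDerivAt_id (0 : ℝ)).smul_const u).const_add x
  have hg : HasDerivAt (F ∘ fun t : ℝ => x + t • u) (L u) 0 :=
    hF.comp_hasDerivAt_of_eq 0 hγ (by simp)
  have hslope := hg.tendsto_slope_zero_right
  have hev : ∀ᶠ t in 𝓝[>] (0 : ℝ), (x + t • u) ∈ {y | 0 < F y} := by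
    filter_upwards [hslope.eventually (lt_mem_nhds hu), self_mem_nhdsWithin] with t ht ht0
    have ht0 : (0 : ℝ) < t := ht0
    have : 0 < t⁻¹ * F (x + t • u) := by simpa [hx] using ht
    exact (pos_iff_pos_of_mul_pos this).mp (inv_pos.mpr ht0)
  have hpath : Tendsto (fun t : ℝ => x + t • u) (𝓝[>] (0 : ℝ)) (𝓝 x) :=
    ((continuous_const.add (continuous_id.smul continuous_const)).tendsto' 0 x (by simp)).mono_left
      nhdsWithin_le_nhds
  exact mem_closure_of_tendsto hpath hev

/-- If `F` has derivative `L ≠ 0` at a zero `x`, then `x` lies in the closure of `{F < 0}`.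
[folklore] -/
theorem mem_closure_setOf_neg_of_hasFDerivAt {F : E → ℝ} {L : E →L[ℝ] ℝ} {x : E}
    (hF : HasFDerivAt F L x) (hx : F x = 0) (hL : L ≠ 0) : x ∈ closure {y | F y < 0} := by
  have h := mem_closure_setOf_pos_of_hasFDerivAt hF.neg (by simp [hx]) (neg_ne_zero.mpr hL)
  simpa using h

/-- In the fact's phrasing `fderiv ℝ F x ≠ 0`: `F` is then differentiable at `x`, with
derivative `fderiv ℝ F x`. [folklore] -/
theorem hasFDerivAt_of_fderiv_ne_zero {F : E → ℝ} {x : E} (h : fderiv ℝ F x ≠ 0) :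
    HasFDerivAt F (fderiv ℝ F x) x := by
  by_contra h'
  exact h (fderiv_zero_of_not_differentiableAt fun hd => h' hd.hasFDerivAt)

/-! ### Boundary, interior and closure of `{F ≤ 0}` -/

section Sets

variable {F : E → ℝ}

/-- `closure {F < 0} = {F ≤ 0}` when `F` is continuous and regular on `{F = 0}`. [folklore] -/
theorem closure_setOf_neg_eq (hcont : Continuous F) (hreg : ∀ x, F x = 0 → fderiv ℝ F x ≠ 0) :
    closure {y | F y < 0} = {y | F y ≤ 0} := by
  refine (closure_lt_subset_le hcont continuous_const).antisymm fun y hy => ?_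
  have hy' : F y ≤ 0 := hy
  rcases hy'.lt_or_eq with h | h
  · exact subset_closure h
  · exact mem_closure_setOf_neg_of_hasFDerivAt (hasFDerivAt_of_fderiv_ne_zero (hreg y h)) h
      (hreg y h)

/-- `interior {F ≤ 0} = {F < 0}` when `F` is continuous and regular on `{F = 0}`: no zero of `F`
is an interior point of the domain. [folklore] -/
theorem interior_setOf_nonpos_eq (hcont : Continuous F)
    (hreg : ∀ x, F x = 0 → fderiv ℝ F x ≠ 0) :
    interior {y | F y ≤ 0} = {y | F y < 0} := by
  refine Subset.antisymm (fun y hy => ?_) (lt_subset_interior_le hcont continuous_const)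
  have hy' : y ∈ {y | F y ≤ 0} := interior_subset hy
  have hy'' : F y ≤ 0 := hy'
  rcases hy''.lt_or_eq with h | h
  · exact h
  · exfalso
    have hcl := mem_closure_setOf_pos_of_hasFDerivAt (hasFDerivAt_of_fderiv_ne_zero (hreg y h))
      h (hreg y h)
    have : {z : E | 0 < F z} = {z | F z ≤ 0}ᶜ := by ext; simp [not_le]
    rw [this, closure_compl] at hcl
    exact hcl hy

/-- **The zero set is the boundary of the domain**: `frontier {F ≤ 0} = {F = 0}` when `F` is
continuous and regular on `{F = 0}` (so `∂D_f = f(N)` for the compact domain of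
Lawson–Michelsohn's Thm. (6.1) presented as `{F ≤ 0}`). [folklore] -/
theorem frontier_setOf_nonpos_eq (hcont : Continuous F)
    (hreg : ∀ x, F x = 0 → fderiv ℝ F x ≠ 0) :
    frontier {y | F y ≤ 0} = {y | F y = 0} := by
  rw [frontier, interior_setOf_nonpos_eq hcont hreg,
    (isClosed_le hcont continuous_const).closure_eq]
  ext y
  simp only [Set.mem_sdiff, mem_setOf_eq, not_lt]
  exact ⟨fun h => le_antisymm h.1 h.2, fun h => ⟨h.le, h.ge⟩⟩

/-- `frontier {F < 0} = {F = 0}` as well. [folklore] -/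
theorem frontier_setOf_neg_eq (hcont : Continuous F) (hreg : ∀ x, F x = 0 → fderiv ℝ F x ≠ 0) :
    frontier {y | F y < 0} = {y | F y = 0} := by
  rw [frontier, closure_setOf_neg_eq hcont hreg, (isOpen_lt hcont continuous_const).interior_eq]
  ext y
  simp only [Set.mem_sdiff, mem_setOf_eq, not_lt]
  exact ⟨fun h => le_antisymm h.1 h.2, fun h => ⟨h.le, h.ge⟩⟩

/-- A nonempty regular zero set forces a nonempty interior `{F < 0}`. [folklore] -/
theorem setOf_neg_nonempty (hreg : ∀ x, F x = 0 → fderiv ℝ F x ≠ 0)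
    (hZ : {y | F y = 0}.Nonempty) : {y | F y < 0}.Nonempty := by
  obtain ⟨x, hx⟩ := hZ
  have := mem_closure_setOf_neg_of_hasFDerivAt (hasFDerivAt_of_fderiv_ne_zero (hreg x hx)) hx
    (hreg x hx)
  have hne : (closure {y | F y < 0}).Nonempty := ⟨x, this⟩
  simpa [closure_nonempty_iff] using hne

omit [NormedAddCommGroup E] [NormedSpace ℝ E] in
/-- The zero set lies in the domain `{F ≤ 0}` (trivial, recorded for the assembly). [folklore] -/
theorem setOf_eq_subset_setOf_nonpos : {y | F y = 0} ⊆ {y : E | F y ≤ 0} := fun _ h =>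
  (le_of_eq h : _)

/-- **The domain is connected when its zero set is**: if `F` is continuous and its zero set
`Z = {F = 0}` is connected (and nonempty), then `D = {F ≤ 0}` is connected — no regularity is
needed. Indeed, if `D = A ⊔ B` with `A`, `B` relatively clopen, the piece missing the connected
set `Z` is contained in the open set `{F < 0}`, hence open in `E`, and closed; `E` being connected
it is empty. (For Lawson–Michelsohn's `D_f ⊆ ℝ^{m+1}` with connected boundary `f(N)`.)
[folklore] -/
theorem isConnected_setOf_nonpos (hcont : Continuous F) (hZ : IsConnected {y | F y = 0}) :
    IsConnected {y | F y ≤ 0} := by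
  set D : Set E := {y | F y ≤ 0} with hD
  set Z : Set E := {y | F y = 0} with hZdef
  set U : Set E := {y | F y < 0} with hU
  have hZD : Z ⊆ D := setOf_eq_subset_setOf_nonpos
  have hDZU : ∀ y ∈ D, y ∉ Z → y ∈ U := fun y (hy : F y ≤ 0) (hyZ : ¬F y = 0) =>
    (lt_of_le_of_ne hy hyZ : F y < 0)
  have hUo : IsOpen U := isOpen_lt hcont continuous_const
  have hDc : IsClosed D := isClosed_le hcont continuous_const
  refine ⟨hZ.nonempty.mono hZD, isPreconnected_closed_iff.mpr ?_⟩
  intro t t' ht ht' hcover hDt hDt'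
  by_contra hempty
  rw [not_nonempty_iff_eq_empty] at hempty
  -- `Z` misses `t` or misses `t'`
  have hZside : Z ∩ t = ∅ ∨ Z ∩ t' = ∅ := by
    by_contra h
    push Not at h
    obtain ⟨h1, h2⟩ := h
    have := isPreconnected_closed_iff.mp hZ.isPreconnected t t' ht ht' (hZD.trans hcover)
      h1 h2
    obtain ⟨z, hz⟩ := this
    have : z ∈ D ∩ (t ∩ t') := ⟨hZD hz.1, hz.2⟩
    rw [hempty] at this
    exact this
  -- the piece of `D` on the side missing `Z` is clopen, nonempty and misses `Z`: impossible
  have key : ∀ s s' : Set E, IsClosed s → IsClosed s' → D ⊆ s ∪ s' → (D ∩ s').Nonempty →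
      D ∩ (s ∩ s') = ∅ → Z ∩ s' = ∅ → False := by
    intro s s' hs hs' hcov hne hint hZs'
    -- `B = D ∩ s'` equals `U ∩ sᶜ`
    have hB : D ∩ s' = U ∩ sᶜ := by
      ext y
      constructor
      · rintro ⟨hyD, hys'⟩
        have hyZ : y ∉ Z := fun hyZ => by
          have : y ∈ Z ∩ s' := ⟨hyZ, hys'⟩
          rw [hZs'] at this
          exact this
        refine ⟨hDZU y hyD hyZ, fun hys => ?_⟩
        have : y ∈ D ∩ (s ∩ s') := ⟨hyD, hys, hys'⟩
        rw [hint] at this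
        exact this
      · rintro ⟨hyU, hys⟩
        have hyU' : F y < 0 := hyU
        have hyD : y ∈ D := show F y ≤ 0 from le_of_lt hyU'
        exact ⟨hyD, (hcov hyD).resolve_left hys⟩
    have hclopen : IsClopen (D ∩ s') :=
      ⟨hDc.inter hs', by rw [hB]; exact hUo.inter hs.isOpen_compl⟩
    rcases isClopen_iff.mp hclopen with h | h
    · exact hne.ne_empty h
    · obtain ⟨z, hz⟩ := hZ.nonempty
      have hz' : z ∈ D ∩ s' := by rw [h]; trivial
      have : z ∈ Z ∩ s' := ⟨hz, hz'.2⟩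
      rw [hZs'] at this
      exact this
  rcases hZside with h | h
  · refine key t' t ht' ht (by rwa [union_comm]) hDt (by rwa [inter_comm t' t]) h
  · exact key t t' ht ht' hcover hDt' hempty h

/-- In the setting of `LawsonMichelsohn1984_surrounding`: the zero set is the image `e(N)` of a
connected `N`, so the domain `{F ≤ 0}` is connected. [folklore] -/
theorem isConnected_setOf_nonpos_of_range_eq {N : Type*} [TopologicalSpace N] [ConnectedSpace N]
    (hcont : Continuous F) {e : N → E} (he : Continuous e) (hrange : range e = {x | F x = 0}) :
    IsConnected {y | F y ≤ 0} :=
  isConnected_setOf_nonpos hcont (hrange ▸ isConnected_range he)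

omit [NormedSpace ℝ E] in
/-- The zero set of a continuous `F` with compact `{F ≤ 0}` is compact. [folklore] -/
theorem isCompact_setOf_eq_zero (hcont : Continuous F) (hD : IsCompact {y | F y ≤ 0}) :
    IsCompact {y | F y = 0} :=
  hD.of_isClosed_subset (isClosed_eq hcont continuous_const) setOf_eq_subset_setOf_nonpos

end Sets

end Literature.Geometry.Riemannian

end
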